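import Literature.AlgebraicGeometry.Motives.FaltingsECEndCoreFrontierProofs
import Literature.AlgebraicGeometry.Motives.FaltingsECEndCoreSupersingularUnramifiedProofs
import HarnessLib

/-!
# Faltings 1983, Satz 4 for an elliptic curve: the frontier of the core fact after the
# unramified supersingular case

Theorem-only sequel of `FaltingsECEndCoreFrontierProofs` (`…_of_residual_supersingular`) and
`FaltingsECEndCoreSupersingularUnramifiedProofs` (Serre 1972, §1.11: an absolutely unramified
place of odd residue degree with good supersingular reduction settles the core fact).  Since a
good model at such a place is either ordinary (unit Hasse invariant,
`…_of_isUnit_hasseCoeff_of_extension`) or supersingular (`…_of_supersingular_unramified_of_extension`),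
**for every prime `ℓ` the named fact `exists_eq_smul_one_of_equivariant_of_not_hasRationalCM W ℓ`
over a number field now reduces to**: `¬ HasCM`, `K` totally imaginary, `j(E) ∈ 𝓞_K`, no finite
extension `L/K` has a place `w ∣ ℓ` carrying a good model of `E_L` with unit Hasse invariant
(potentially supersingular reduction everywhere above `ℓ`), **and no finite extension `L/K` has a
place `w` at which `ℓ` is a uniformizer, of odd residue degree over `𝔽_ℓ`, where `E_L` has good
reduction** (`exists_eq_smul_one_of_equivariant_of_not_hasRationalCM_of_residual_heartland`).
What is left is the "fake complex multiplication" heartland of Serre's theorem (1968, IV.2.2),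
where the local Galois structure at `ℓ` is that of a curve with complex multiplication by a field
in which `ℓ` is inert or ramified, and only the Hodge–Tate decomposition (Serre 1968, III) or
Faltings' Finiteness I decides.

## References

* [Serre1972] J.-P. Serre, Invent. Math. 15 (1972), §1.11.
* [SerreAbelianLadic1968] J.-P. Serre, *Abelian ℓ-adic representations and elliptic curves*
  (1968), IV.2.2.
* [Faltings1983Endlichkeit] G. Faltings, Invent. Math. 73 (1983), §5 Satz 4.
-/

noncomputable section

open scoped TensorProduct

universe u

namespace Literature.AlgebraicGeometry.Motives

open WeierstrassCurve Module Literature.NumberTheory.EllipticCurves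
  Literature.NumberTheory.GaloisRepresentations Field IsDedekindDomain
open scoped NumberField

variable {K : Type u} [Field K] (W : WeierstrassCurve K) (ℓ : ℕ) [hℓ : Fact ℓ.Prime]

/-- **Good reduction at an absolutely unramified place of odd residue degree settles the named
core fact**: if some finite extension `L/K` has a place `w` with
`w.valuation L ℓ = exp (-1)`, `#(𝓞 L ⧸ w) = ℓᶠ` with `f` odd, and a good model `M` of `E_L` at
`w`, then `exists_eq_smul_one_of_equivariant_of_not_hasRationalCM W ℓ` holds — by the ordinary
case if the Hasse invariant (`a₁(M)` for `ℓ = 2`, `A_ℓ(M)` otherwise) is a unit and by the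
supersingular case otherwise.
[cite: Serre1972, §1.11 Prop. 11–12] [cite: Faltings1983Endlichkeit, §5 Satz 4] -/
theorem exists_eq_smul_one_of_equivariant_of_not_hasRationalCM_of_good_unramified_of_extension
    (L : Type u) [Field L] [NumberField L] [Algebra K L]
    {w : HeightOneSpectrum (𝓞 L)} (hℓw : w.valuation L (ℓ : L) = WithZero.exp (-1 : ℤ))
    {f : ℕ} (hf : Odd f) (hq : Nat.card (𝓞 L ⧸ w.asIdeal) = ℓ ^ f)
    {C : VariableChange (w.adicCompletion L)} {M : WeierstrassCurve (w.adicCompletionIntegers L)}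
    (hCM : C • (W.baseChange L).baseChange (w.adicCompletion L) =
      M.map (algebraMap (w.adicCompletionIntegers L) (w.adicCompletion L))) (hΔ : IsUnit M.Δ) :
    exists_eq_smul_one_of_equivariant_of_not_hasRationalCM W ℓ := by
  -- introduce the (instance) hypotheses of the named fact, so that the case split below runs
  -- in a context containing `[NumberField K] [W.IsElliptic]`
  intro hK hE hRCM hnl G hG
  -- `ℓ ∈ w` from `w.valuation L ℓ = exp (-1) < 1`
  have hℓmem : (ℓ : 𝓞 L) ∈ w.asIdeal := by
    apply (w.valuation_lt_one_iff_mem (K := L) (ℓ : 𝓞 L)).mp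
    change w.valuation L (algebraMap (𝓞 L) L (ℓ : 𝓞 L)) < 1
    rw [map_natCast, hℓw, ← WithZero.exp_zero, WithZero.exp_lt_exp]
    norm_num
  have key : exists_eq_smul_one_of_equivariant_of_not_hasRationalCM W ℓ := by
    by_cases hℓ2 : ℓ = 2
    · by_cases hA : IsUnit M.a₁
      · -- ordinary above `2`
        subst hℓ2
        have h2w : (2 : 𝓞 L) ∈ w.asIdeal := by exact_mod_cast hℓmem
        exact exists_eq_smul_one_of_equivariant_of_not_hasRationalCM_of_isUnit_a₁_of_extension W L h2w
          hCM hΔ hA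
      · exact exists_eq_smul_one_of_equivariant_of_not_hasRationalCM_of_supersingular_unramified_of_extension
          W ℓ L hℓw hf hq hCM hΔ (by rw [if_pos hℓ2]; exact (IsLocalRing.mem_maximalIdeal _).mpr hA)
    · by_cases hA : IsUnit (M.hasseCoeff ℓ)
      · exact exists_eq_smul_one_of_equivariant_of_not_hasRationalCM_of_isUnit_hasseCoeff_of_extension
          W ℓ L hℓmem hℓ2 hCM hΔ hA
      · exact exists_eq_smul_one_of_equivariant_of_not_hasRationalCM_of_supersingular_unramified_of_extension
          W ℓ L hℓw hf hq hCM hΔ (by rw [if_neg hℓ2]; exact (IsLocalRing.mem_maximalIdeal _).mpr hA)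
  exact key hRCM hnl G hG

/-- **Good reduction at an absolutely unramified place of `K` of odd residue degree settles the
named core fact** (the case `L = K` of the previous theorem, stated for a model of `E` itself):
`v` a finite place of `K` with `v.valuation K ℓ = exp (-1)`, `#(𝓞 K ⧸ v) = ℓᶠ` with `f` odd, and a
good model `M` of `E` at `v`. [cite: Serre1972, §1.11 Prop. 11–12] [cite: Faltings1983Endlichkeit, §5 Satz 4] -/
theorem exists_eq_smul_one_of_equivariant_of_not_hasRationalCM_of_good_unramified [NumberField K]
    {v : HeightOneSpectrum (𝓞 K)} (hℓv : v.valuation K (ℓ : K) = WithZero.exp (-1 : ℤ))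
    {f : ℕ} (hf : Odd f) (hq : Nat.card (𝓞 K ⧸ v.asIdeal) = ℓ ^ f)
    {C : VariableChange (v.adicCompletion K)} {M : WeierstrassCurve (v.adicCompletionIntegers K)}
    (hCM : C • W.baseChange (v.adicCompletion K) =
      M.map (algebraMap (v.adicCompletionIntegers K) (v.adicCompletion K))) (hΔ : IsUnit M.Δ) :
    exists_eq_smul_one_of_equivariant_of_not_hasRationalCM W ℓ := by
  intro hK hE hRCM hnl G hG
  have hℓmem : (ℓ : 𝓞 K) ∈ v.asIdeal := by
    apply (v.valuation_lt_one_iff_mem (K := K) (ℓ : 𝓞 K)).mp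
    change v.valuation K (algebraMap (𝓞 K) K (ℓ : 𝓞 K)) < 1
    rw [map_natCast, hℓv, ← WithZero.exp_zero, WithZero.exp_lt_exp]
    norm_num
  have key : exists_eq_smul_one_of_equivariant_of_not_hasRationalCM W ℓ := by
    by_cases hℓ2 : ℓ = 2
    · by_cases hA : IsUnit M.a₁
      · subst hℓ2
        have h2v : (2 : 𝓞 K) ∈ v.asIdeal := by exact_mod_cast hℓmem
        exact exists_eq_smul_one_of_equivariant_of_not_hasRationalCM_of_isUnit_a₁ W h2v hCM hΔ hA
      · exact exists_eq_smul_one_of_equivariant_of_not_hasRationalCM_of_supersingular_unramified W ℓ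
          hℓv hf hq hCM hΔ (by rw [if_pos hℓ2]; exact (IsLocalRing.mem_maximalIdeal _).mpr hA)
    · by_cases hA : IsUnit (M.hasseCoeff ℓ)
      · exact exists_eq_smul_one_of_equivariant_of_not_hasRationalCM_of_isUnit_hasseCoeff W ℓ hℓmem
          hℓ2 hCM hΔ hA
      · exact exists_eq_smul_one_of_equivariant_of_not_hasRationalCM_of_supersingular_unramified W ℓ
          hℓv hf hq hCM hΔ (by rw [if_neg hℓ2]; exact (IsLocalRing.mem_maximalIdeal _).mpr hA)
  exact key hRCM hnl G hG

/-- **The subspace statement for `E × E` (`stable_subspace_prod_eq_range W ℓ`) for a curve with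
good reduction at an absolutely unramified place of `K` of odd residue degree above `ℓ`** —
unconditional. [cite: Faltings1983Endlichkeit, §5, Sätze 3–4] -/
theorem stable_subspace_prod_eq_range_of_good_unramified [NumberField K]
    {v : HeightOneSpectrum (𝓞 K)} (hℓv : v.valuation K (ℓ : K) = WithZero.exp (-1 : ℤ))
    {f : ℕ} (hf : Odd f) (hq : Nat.card (𝓞 K ⧸ v.asIdeal) = ℓ ^ f)
    {C : VariableChange (v.adicCompletion K)} {M : WeierstrassCurve (v.adicCompletionIntegers K)}
    (hCM : C • W.baseChange (v.adicCompletion K) =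
      M.map (algebraMap (v.adicCompletionIntegers K) (v.adicCompletion K))) (hΔ : IsUnit M.Δ) :
    stable_subspace_prod_eq_range W ℓ := by
  intro _ _
  exact stable_subspace_prod_eq_range_of_core W ℓ
    (exists_eq_smul_one_of_equivariant_of_not_hasRationalCM_of_good_unramified W ℓ hℓv hf hq hCM hΔ)

/-- **Faltings' Satz 4 (`mem_span_range_tateEndRingHom_iff W ℓ`) for a curve with good reduction
at an absolutely unramified place of `K` of odd residue degree above `ℓ`** — unconditional.
[cite: Faltings1983Endlichkeit, §5 Satz 4] -/
theorem mem_span_range_tateEndRingHom_iff_of_good_unramified [NumberField K]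
    {v : HeightOneSpectrum (𝓞 K)} (hℓv : v.valuation K (ℓ : K) = WithZero.exp (-1 : ℤ))
    {f : ℕ} (hf : Odd f) (hq : Nat.card (𝓞 K ⧸ v.asIdeal) = ℓ ^ f)
    {C : VariableChange (v.adicCompletion K)} {M : WeierstrassCurve (v.adicCompletionIntegers K)}
    (hCM : C • W.baseChange (v.adicCompletion K) =
      M.map (algebraMap (v.adicCompletionIntegers K) (v.adicCompletion K))) (hΔ : IsUnit M.Δ) :
    mem_span_range_tateEndRingHom_iff W ℓ := by
  intro _ _
  exact mem_span_range_tateEndRingHom_iff_of_isogenyClass_of_core W ℓ (finite_isogenyClass_holds W)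
    (exists_eq_smul_one_of_equivariant_of_not_hasRationalCM_of_good_unramified W ℓ hℓv hf hq hCM hΔ)

/-- **The frontier after the unramified supersingular case.**  Over a number field, the named
fact `exists_eq_smul_one_of_equivariant_of_not_hasRationalCM W ℓ` reduces to the case:
`¬ HasCM`, `K` totally imaginary, `j(E) ∈ 𝓞_K`, no finite extension `L/K` has a place `w ∣ ℓ`
with a good model of `E_L` whose Hasse invariant (`a₁` if `ℓ = 2`, `A_ℓ` otherwise) is a unit,
**and no finite extension `L/K` has a place `w` at which `ℓ` is a uniformizer, with residue field
of odd degree over `𝔽_ℓ`, carrying a good model of `E_L`**.  (The last clause is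
Serre 1972, §1.11; what remains needs the Hodge–Tate decomposition, Serre 1968 III / IV.2.2, or
Faltings' Finiteness I, `AbelianVariety.finite_isoClasses_isogenous`.)
[cite: SerreAbelianLadic1968, IV.2.2] [cite: Serre1972, §1.11] [cite: Faltings1983Endlichkeit, §5 Satz 4] -/
theorem exists_eq_smul_one_of_equivariant_of_not_hasRationalCM_of_residual_heartland
    [NumberField K] [W.IsElliptic]
    (h : ¬ W.HasCM → IsEmpty (K →+* ℝ) →
      (∀ v : HeightOneSpectrum (𝓞 K), v.valuation K W.j ≤ 1) →
      (∀ (L : Type u) [Field L] [NumberField L] [Algebra K L]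
          (w : HeightOneSpectrum (𝓞 L)) (C : VariableChange (w.adicCompletion L))
          (M : WeierstrassCurve (w.adicCompletionIntegers L)), (ℓ : 𝓞 L) ∈ w.asIdeal →
          C • (W.baseChange L).baseChange (w.adicCompletion L) =
            M.map (algebraMap (w.adicCompletionIntegers L) (w.adicCompletion L)) →
          IsUnit M.Δ → ¬ IsUnit (if ℓ = 2 then M.a₁ else M.hasseCoeff ℓ)) →
      (∀ (L : Type u) [Field L] [NumberField L] [Algebra K L]
          (w : HeightOneSpectrum (𝓞 L)) (f : ℕ) (C : VariableChange (w.adicCompletion L))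
          (M : WeierstrassCurve (w.adicCompletionIntegers L)),
          w.valuation L (ℓ : L) = WithZero.exp (-1 : ℤ) → Odd f →
          Nat.card (𝓞 L ⧸ w.asIdeal) = ℓ ^ f →
          C • (W.baseChange L).baseChange (w.adicCompletion L) =
            M.map (algebraMap (w.adicCompletionIntegers L) (w.adicCompletion L)) →
          ¬ IsUnit M.Δ) →
      exists_eq_smul_one_of_equivariant_of_not_hasRationalCM W ℓ) :
    exists_eq_smul_one_of_equivariant_of_not_hasRationalCM W ℓ := by
  refine exists_eq_smul_one_of_equivariant_of_not_hasRationalCM_of_residual_supersingular W ℓ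
    fun hCM hR hint hord ↦ ?_
  by_cases hgood : ∀ (L : Type u) [Field L] [NumberField L] [Algebra K L]
      (w : HeightOneSpectrum (𝓞 L)) (f : ℕ) (C : VariableChange (w.adicCompletion L))
      (M : WeierstrassCurve (w.adicCompletionIntegers L)),
      w.valuation L (ℓ : L) = WithZero.exp (-1 : ℤ) → Odd f →
      Nat.card (𝓞 L ⧸ w.asIdeal) = ℓ ^ f →
      C • (W.baseChange L).baseChange (w.adicCompletion L) =
        M.map (algebraMap (w.adicCompletionIntegers L) (w.adicCompletion L)) →
      ¬ IsUnit M.Δ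
  · exact h hCM hR hint hord hgood
  · push Not at hgood
    obtain ⟨L, _, _, _, w, f, C, M, hℓw, hf, hq, hCM', hΔ⟩ := hgood
    exact exists_eq_smul_one_of_equivariant_of_not_hasRationalCM_of_good_unramified_of_extension W ℓ L
      hℓw hf hq hCM' hΔ

/-- **The subspace statement for `E × E` (`stable_subspace_prod_eq_range W ℓ`) under the same
reduction**: it holds as soon as the heartland hypotheses fail, in particular whenever some finite
extension of `K` has a place at which `ℓ` is a uniformizer, of odd residue degree, of good
reduction for `E`. [cite: Faltings1983Endlichkeit, §5, Sätze 3–4] -/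
theorem stable_subspace_prod_eq_range_of_good_unramified_of_extension
    (L : Type u) [Field L] [NumberField L] [Algebra K L]
    {w : HeightOneSpectrum (𝓞 L)} (hℓw : w.valuation L (ℓ : L) = WithZero.exp (-1 : ℤ))
    {f : ℕ} (hf : Odd f) (hq : Nat.card (𝓞 L ⧸ w.asIdeal) = ℓ ^ f)
    {C : VariableChange (w.adicCompletion L)} {M : WeierstrassCurve (w.adicCompletionIntegers L)}
    (hCM : C • (W.baseChange L).baseChange (w.adicCompletion L) =
      M.map (algebraMap (w.adicCompletionIntegers L) (w.adicCompletion L))) (hΔ : IsUnit M.Δ) :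
    stable_subspace_prod_eq_range W ℓ :=
  stable_subspace_prod_eq_range_of_core W ℓ
    (exists_eq_smul_one_of_equivariant_of_not_hasRationalCM_of_good_unramified_of_extension W ℓ L hℓw
      hf hq hCM hΔ)

end Literature.AlgebraicGeometry.Motives

end
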